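import Mathlib
import Summits.Ventures.HodgeRepro.Tier4.Target
import Summits.Ventures.HodgeRepro.Tier4.Common.RowPlane
import Summits.Ventures.HodgeRepro.Tier4.Common.MixedPlaneCusp
import Summits.Ventures.HodgeRepro.Tier4.Common.MixedPlaneKType

/-!
# Tier4/Line4/SeesawAnisotropic — C-L4-ANISO: the seesaw plane of two `H`-orthogonal lines is ANISOTROPIC because `H` is

Blind re-derivation cell `pub-hodge-repro`, Tier 4 «prove the step» (README §9–§10), seat t4-L2-p2 g6 (prover; plan-4 g7's
idle-prover cut (ii) «`seesawPlane_anisotropic_of_hani`», HANDOFF cycle 2; TAKEN S16092).  Tree path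
`lean/Summits/Ventures/HodgeRepro/Tier4/Line4/SeesawAnisotropic.lean`.  Imports `Tier4/Target` (`hform`, `IsCHermitian`,
`Anisotropic`), typer-2's `Common/RowPlane` (`PlaneData.mixedRow`, `lineGramRow`), `Common/MixedPlaneCusp` (`IsAnisotropic`,
`IsIsotropic`) and `Common/MixedPlaneKType` (`PlaneData.withTransportedTorus`).  Mathlib-level; no literature; no `def`.

THE SUBSPACE READING (plan-4's census ERRATUM-2 / S16008 dictionary `a 0 := H(e₁,e₁)`, `a 2 := −H(e₂,e₂)`): the seesaw
plane `⟨a₀⟩ ⊕ ⟨−a₂⟩` is `H|_{W₁ ⊕ W₃}` for the `H`-orthogonal lines `W₁ = E e₁`, `W₃ = E e₂`, so a non-zero isotropic vector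
of its trace form over `k = E⁺` would be a non-zero `H`-isotropic vector of `V` — against `Anisotropic c H`.
Explicitly, for `ℓ = (x₁, x₂, y₁, y₂) ∈ k⁴` put `ξ := x₂ − x₁ ω`, `η := y₂ − y₁ ω` (the coordinates of `E = k(ω)`) and
`v := ξ e₁ + η e₂`; then `algebraMap k E (ℓ ⬝ B ℓ) = 2 ⟨v, v⟩_H`, because `lineGramRow q a` has the quadratic form
`2 a (n x₁² − t x₁ x₂ + x₂²)` and `c(ξ) ξ = x₂² − t x₁ x₂ + n x₁²` (`c ω = t − ω`, `ω² = t ω − n`), while the cross terms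
vanish by the orthogonality (`⟨e₂, e₁⟩ = c ⟨e₁, e₂⟩` from `hH`).  An isotropic `ℓ` gives `⟨v, v⟩ = 0`, so `v = 0`, so
`ξ = η = 0` (pair against `e₁`, `e₂`: `h₁`, `h₂`), and `ξ = 0` forces `x₁ = x₂ = 0` (otherwise `ω ∈ k` would be fixed by
`c`, against `c ω ≠ ω`).  No trace-zero hypothesis is needed.

The statement is on the tree's vocabulary: the skeleton's `seesawPlane q a g g' …` is by delta
`(PlaneData.mixedRow q (a 0) (a 2)).withTransportedTorus g g' hgg' hg'g hgΩ` (the conclusion here) and `DescribesCM q` is the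
explicit `ω` with `ω² = t ω − n`, `c ω = t − ω`, `c ω ≠ ω` (the three binders `hω hcω hne` here).

Nothing here says anything about the status of the Hodge conjecture for CM abelian varieties, which is NOT proved
(HC_CM is NOT proved by anyone in this repository).
-/

set_option autoImplicit false

noncomputable section

namespace Summit.Ventures.HodgeRepro.Tier4.Line4

open Summit.Ventures.HodgeRepro.Tier4 Summit.Ventures.HodgeRepro.Tier4.Common NumberField Matrix

/-! ## The quadratic form of the mixed row plane -/

section Coords

variable {k : Type}

/-- The first block coordinates of `ℓ : Fin 4 → k`. -/
theorem comp_finSumFinEquiv_inl (ℓ : Fin 4 → k) :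
    ℓ ∘ ⇑(finSumFinEquiv : Fin 2 ⊕ Fin 2 ≃ Fin 4) ∘ Sum.inl = ![ℓ 0, ℓ 1] := by
  funext i
  fin_cases i <;> rfl

/-- The second block coordinates of `ℓ : Fin 4 → k`. -/
theorem comp_finSumFinEquiv_inr (ℓ : Fin 4 → k) :
    ℓ ∘ ⇑(finSumFinEquiv : Fin 2 ⊕ Fin 2 ≃ Fin 4) ∘ Sum.inr = ![ℓ 2, ℓ 3] := by
  funext i
  fin_cases i <;> rfl

end Coords

section QuadForm

variable {k : Type} [Field k]

/-- The quadratic form of a block-diagonal matrix splits into the two blocks. -/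
theorem dotProduct_blockDiag4_mulVec (A D : Matrix (Fin 2) (Fin 2) k) (ℓ : Fin 4 → k) :
    ℓ ⬝ᵥ (blockDiag4 A D *ᵥ ℓ) =
      (ℓ ∘ ⇑(finSumFinEquiv : Fin 2 ⊕ Fin 2 ≃ Fin 4) ∘ Sum.inl) ⬝ᵥ (A *ᵥ (ℓ ∘ ⇑(finSumFinEquiv : Fin 2 ⊕ Fin 2 ≃ Fin 4) ∘ Sum.inl)) +
        (ℓ ∘ ⇑(finSumFinEquiv : Fin 2 ⊕ Fin 2 ≃ Fin 4) ∘ Sum.inr) ⬝ᵥ (D *ᵥ (ℓ ∘ ⇑(finSumFinEquiv : Fin 2 ⊕ Fin 2 ≃ Fin 4) ∘ Sum.inr)) := by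
  have hsplit : ℓ ∘ ⇑(finSumFinEquiv : Fin 2 ⊕ Fin 2 ≃ Fin 4) =
      Sum.elim (ℓ ∘ ⇑(finSumFinEquiv : Fin 2 ⊕ Fin 2 ≃ Fin 4) ∘ Sum.inl) (ℓ ∘ ⇑(finSumFinEquiv : Fin 2 ⊕ Fin 2 ≃ Fin 4) ∘ Sum.inr) := by
    funext i
    cases i <;> rfl
  rw [blockDiag4, re4, Matrix.coe_reindexAlgEquiv, Matrix.reindex_apply, Matrix.submatrix_mulVec_equiv,
    Equiv.symm_symm, dotProduct_comp_equiv_symm, Matrix.fromBlocks_mulVec, hsplit,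
    sumElim_dotProduct_sumElim]
  simp only [Sum.elim_comp_inl, Sum.elim_comp_inr, Matrix.zero_mulVec, add_zero, zero_add]

/-- The quadratic form of the row line Gram matrix `lineGramRow q a`: `2 a (n x² − t x y + y²)`. -/
theorem dotProduct_lineGramRow_mulVec (q : QuadData k) (a x y : k) :
    ![x, y] ⬝ᵥ (lineGramRow q a *ᵥ ![x, y]) = 2 * a * (q.n * x ^ 2 - q.t * x * y + y ^ 2) := by
  simp [lineGramRow, dotProduct, mulVec, Fin.sum_univ_two]
  ring

/-- **The quadratic form of the mixed row plane `⟨a⟩ ⊕ ⟨−b⟩`** at `ℓ = (x₁, x₂, y₁, y₂)`: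
`2 a (n x₁² − t x₁ x₂ + x₂²) − 2 b (n y₁² − t y₁ y₂ + y₂²)`. -/
theorem dotProduct_mixedRow_B_mulVec (q : QuadData k) (a b : k) (ℓ : Fin 4 → k) :
    ℓ ⬝ᵥ ((PlaneData.mixedRow q a b).B *ᵥ ℓ) =
      2 * a * (q.n * ℓ 0 ^ 2 - q.t * ℓ 0 * ℓ 1 + ℓ 1 ^ 2) - 2 * b * (q.n * ℓ 2 ^ 2 - q.t * ℓ 2 * ℓ 3 + ℓ 3 ^ 2) := by
  rw [PlaneData.mixedRow, ofLinesRow_B, dotProduct_blockDiag4_mulVec, comp_finSumFinEquiv_inl,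
    comp_finSumFinEquiv_inr, dotProduct_lineGramRow_mulVec, Matrix.smul_mulVec, dotProduct_smul,
    dotProduct_lineGramRow_mulVec, smul_eq_mul]
  ring

end QuadForm

/-! ## The hermitian form: conjugate symmetry and the expansion on two vectors -/

section Hermitian

variable {E : Type} [Field E]

/-- For a `c`-hermitian `H` (`c` an involution), `⟨y, x⟩_H = c ⟨x, y⟩_H`. -/
theorem hform_swap (c : E ≃+* E) (hc : ∀ z, c (c z) = z) (H : Matrix (Fin 3) (Fin 3) E)
    (hH : IsCHermitian c H) (x y : Fin 3 → E) : hform c H y x = c (hform c H x y) := by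
  have hentry : ∀ i j, c (H i j) = H j i := by
    intro i j
    have := congrFun (congrFun hH j) i
    simpa only [cstar, Matrix.transpose_apply, Matrix.map_apply] using this
  unfold hform
  simp only [dotProduct, mulVec, map_sum, map_mul, hc, Finset.mul_sum]
  rw [Finset.sum_comm]
  refine Finset.sum_congr rfl fun i _ => Finset.sum_congr rfl fun j _ => ?_
  rw [hentry]
  ring

/-- `⟨ξ x + η y, z⟩_H = c ξ ⟨x, z⟩_H + c η ⟨y, z⟩_H`. -/
theorem hform_add_smul_left (c : E ≃+* E) (H : Matrix (Fin 3) (Fin 3) E) (ξ η : E) (x y z : Fin 3 → E) :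
    hform c H (ξ • x + η • y) z = c ξ * hform c H x z + c η * hform c H y z := by
  unfold hform
  have h : (fun i => c ((ξ • x + η • y) i)) = c ξ • (fun i => c (x i)) + c η • (fun i => c (y i)) := by
    funext i
    simp only [Pi.add_apply, Pi.smul_apply, smul_eq_mul, map_add, map_mul]
  rw [h, add_dotProduct, smul_dotProduct, smul_dotProduct, smul_eq_mul, smul_eq_mul]

/-- `⟨z, ξ x + η y⟩_H = ξ ⟨z, x⟩_H + η ⟨z, y⟩_H`. -/
theorem hform_add_smul_right (c : E ≃+* E) (H : Matrix (Fin 3) (Fin 3) E) (ξ η : E) (x y z : Fin 3 → E) :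
    hform c H z (ξ • x + η • y) = ξ * hform c H z x + η * hform c H z y := by
  unfold hform
  rw [Matrix.mulVec_add, Matrix.mulVec_smul, Matrix.mulVec_smul, dotProduct_add, dotProduct_smul,
    dotProduct_smul, smul_eq_mul, smul_eq_mul]

/-- **The expansion of `⟨v, v⟩_H` on `v = ξ e₁ + η e₂` for `H`-orthogonal `e₁, e₂`**:
`c ξ · ξ · ⟨e₁, e₁⟩ + c η · η · ⟨e₂, e₂⟩`. -/
theorem hform_self_add_smul_of_orth (c : E ≃+* E) (hc : ∀ z, c (c z) = z) (H : Matrix (Fin 3) (Fin 3) E)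
    (hH : IsCHermitian c H) (e₁ e₂ : Fin 3 → E) (horth : hform c H e₁ e₂ = 0) (ξ η : E) :
    hform c H (ξ • e₁ + η • e₂) (ξ • e₁ + η • e₂) =
      c ξ * ξ * hform c H e₁ e₁ + c η * η * hform c H e₂ e₂ := by
  have horth' : hform c H e₂ e₁ = 0 := by rw [hform_swap c hc H hH, horth, map_zero]
  rw [hform_add_smul_left, hform_add_smul_right, hform_add_smul_right, horth, horth']
  ring

end Hermitian

/-! ## The coordinates of `k(ω)` -/

section Coordinates

variable (E : Type) [Field E] [NumberField E] [IsCMField E]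

/-- Complex conjugation fixes the maximal real subfield. -/
theorem complexConj_algebraMap (x : ↥(maximalRealSubfield E)) :
    (IsCMField.complexConj E).toRingEquiv (algebraMap (↥(maximalRealSubfield E)) E x) =
      algebraMap (↥(maximalRealSubfield E)) E x := by
  simp only [AlgEquiv.coe_ringEquiv]
  exact IsCMField.complexConj_apply_eq_self E x

/-- `c ξ · ξ` for `ξ = y − x ω`: the norm form `n x² − t x y + y²` (`c ω = t − ω`, `ω² = t ω − n`). -/
theorem conj_mul_self_sub_mul_omega (q : QuadData ↥(maximalRealSubfield E)) (ω : E)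
    (hω : ω ^ 2 = algebraMap (↥(maximalRealSubfield E)) E q.t * ω - algebraMap (↥(maximalRealSubfield E)) E q.n)
    (hcω : (IsCMField.complexConj E).toRingEquiv ω = algebraMap (↥(maximalRealSubfield E)) E q.t - ω)
    (x y : ↥(maximalRealSubfield E)) :
    (IsCMField.complexConj E).toRingEquiv
        (algebraMap (↥(maximalRealSubfield E)) E y - algebraMap (↥(maximalRealSubfield E)) E x * ω) *
      (algebraMap (↥(maximalRealSubfield E)) E y - algebraMap (↥(maximalRealSubfield E)) E x * ω) =
      algebraMap (↥(maximalRealSubfield E)) E (q.n * x ^ 2 - q.t * x * y + y ^ 2) := by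
  rw [map_sub, map_mul, complexConj_algebraMap, complexConj_algebraMap, hcω]
  simp only [map_sub, map_mul, map_add, map_pow]
  linear_combination (-(algebraMap (↥(maximalRealSubfield E)) E x ^ 2)) * hω

/-- `y − x ω = 0` with `x, y ∈ k` forces `x = y = 0` (`ω ∉ k`: `c ω ≠ ω`). -/
theorem eq_zero_of_sub_mul_omega_eq_zero (ω : E)
    (hne : (IsCMField.complexConj E).toRingEquiv ω ≠ ω) (x y : ↥(maximalRealSubfield E))
    (h : algebraMap (↥(maximalRealSubfield E)) E y - algebraMap (↥(maximalRealSubfield E)) E x * ω = 0) :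
    x = 0 ∧ y = 0 := by
  have hx : x = 0 := by
    by_contra hx
    apply hne
    have hx' : algebraMap (↥(maximalRealSubfield E)) E x ≠ 0 :=
      (map_ne_zero (algebraMap (↥(maximalRealSubfield E)) E)).2 hx
    have hω : ω = algebraMap (↥(maximalRealSubfield E)) E (y / x) := by
      rw [map_div₀, eq_div_iff hx']
      linear_combination -h
    rw [hω, complexConj_algebraMap]
  subst hx
  refine ⟨rfl, ?_⟩
  rw [map_zero, zero_mul, sub_zero] at h
  exact (map_eq_zero (algebraMap (↥(maximalRealSubfield E)) E)).1 h

end Coordinates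

/-! ## The theorem -/

section Aniso

variable (E : Type) [Field E] [NumberField E] [IsCMField E]

/-- **C-L4-ANISO, untransported form**: the mixed row plane `⟨a 0⟩ ⊕ ⟨−a 2⟩` of two `H`-orthogonal lines of an
anisotropic `c`-hermitian `V = (E³, H)` is anisotropic over `k = E⁺` (the subspace reading: its trace form is `2 ⟨v, v⟩_H`
on `v = ξ e₁ + η e₂`). -/
theorem isAnisotropic_mixedRow_of_anisotropic (H : Matrix (Fin 3) (Fin 3) E)
    (hH : IsCHermitian (IsCMField.complexConj E).toRingEquiv H)
    (hani : Anisotropic (IsCMField.complexConj E).toRingEquiv H)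
    (q : QuadData ↥(maximalRealSubfield E)) (ω : E)
    (hω : ω ^ 2 = algebraMap (↥(maximalRealSubfield E)) E q.t * ω - algebraMap (↥(maximalRealSubfield E)) E q.n)
    (hcω : (IsCMField.complexConj E).toRingEquiv ω = algebraMap (↥(maximalRealSubfield E)) E q.t - ω)
    (hne : (IsCMField.complexConj E).toRingEquiv ω ≠ ω)
    (e₁ e₂ : Fin 3 → E) (horth : hform (IsCMField.complexConj E).toRingEquiv H e₁ e₂ = 0)
    (a : Fin 4 → ↥(maximalRealSubfield E))
    (ha0 : algebraMap (↥(maximalRealSubfield E)) E (a 0) = hform (IsCMField.complexConj E).toRingEquiv H e₁ e₁)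
    (ha2 : algebraMap (↥(maximalRealSubfield E)) E (a 2) = -hform (IsCMField.complexConj E).toRingEquiv H e₂ e₂)
    (h₁ : hform (IsCMField.complexConj E).toRingEquiv H e₁ e₁ ≠ 0)
    (h₂ : hform (IsCMField.complexConj E).toRingEquiv H e₂ e₂ ≠ 0) :
    IsAnisotropic (PlaneData.mixedRow q (a 0) (a 2)) := by
  have hc : ∀ z, (IsCMField.complexConj E).toRingEquiv ((IsCMField.complexConj E).toRingEquiv z) = z := by
    intro z
    simp only [AlgEquiv.coe_ringEquiv, IsCMField.complexConj_apply_apply]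
  rintro ⟨ℓ, hℓ, hiso⟩
  -- the vector `v = ξ e₁ + η e₂` of `V`
  set ι := algebraMap (↥(maximalRealSubfield E)) E with hι
  set ξ : E := ι (ℓ 1) - ι (ℓ 0) * ω with hξ
  set η : E := ι (ℓ 3) - ι (ℓ 2) * ω with hη
  -- `algebraMap (ℓ ⬝ B ℓ) = 2 ⟨v, v⟩_H`
  have hquad := congrArg ι hiso
  rw [dotProduct_mixedRow_B_mulVec, map_zero] at hquad
  have hvv : hform (IsCMField.complexConj E).toRingEquiv H (ξ • e₁ + η • e₂) (ξ • e₁ + η • e₂) = 0 := by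
    rw [hform_self_add_smul_of_orth _ hc H hH e₁ e₂ horth, hξ, hη,
      conj_mul_self_sub_mul_omega E q ω hω hcω, conj_mul_self_sub_mul_omega E q ω hω hcω, ← ha0,
      ← neg_neg (hform _ H e₂ e₂), ← ha2]
    simp only [map_sub, map_mul, map_add, map_pow, map_ofNat] at hquad ⊢
    linear_combination hquad / 2
  have hv0 : ξ • e₁ + η • e₂ = 0 := hani _ hvv
  -- `ξ = η = 0` by pairing against `e₁` and `e₂`
  have hξ0 : ξ = 0 := by
    have h : hform (IsCMField.complexConj E).toRingEquiv H e₁ (ξ • e₁ + η • e₂) =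
        hform (IsCMField.complexConj E).toRingEquiv H e₁ 0 := by rw [hv0]
    rw [hform_add_smul_right, horth, mul_zero, add_zero] at h
    have h0 : hform (IsCMField.complexConj E).toRingEquiv H e₁ 0 = 0 := by
      simp only [hform, Matrix.mulVec_zero, dotProduct_zero]
    rw [h0] at h
    exact (mul_eq_zero.1 h).resolve_right h₁
  have hη0 : η = 0 := by
    have horth' : hform (IsCMField.complexConj E).toRingEquiv H e₂ e₁ = 0 := by
      rw [hform_swap _ hc H hH, horth, map_zero]
    have h : hform (IsCMField.complexConj E).toRingEquiv H e₂ (ξ • e₁ + η • e₂) =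
        hform (IsCMField.complexConj E).toRingEquiv H e₂ 0 := by rw [hv0]
    rw [hform_add_smul_right, horth', mul_zero, zero_add] at h
    have h0 : hform (IsCMField.complexConj E).toRingEquiv H e₂ 0 = 0 := by
      simp only [hform, Matrix.mulVec_zero, dotProduct_zero]
    rw [h0] at h
    exact (mul_eq_zero.1 h).resolve_right h₂
  -- the coordinates vanish
  obtain ⟨h0, h1⟩ := eq_zero_of_sub_mul_omega_eq_zero E ω hne (ℓ 0) (ℓ 1) hξ0
  obtain ⟨h2, h3⟩ := eq_zero_of_sub_mul_omega_eq_zero E ω hne (ℓ 2) (ℓ 3) hη0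
  apply hℓ
  funext i
  fin_cases i
  · exact h0
  · exact h1
  · exact h2
  · exact h3

/-- **C-L4-ANISO (plan-4 g7's cut (ii) `seesawPlane_anisotropic_of_hani`, on the tree's vocabulary)**: the seesaw plane of
record `(mixedRow q (a 0) (a 2)).withTransportedTorus g g' …` (= the skeleton's `seesawPlane q a g g' hgg' hg'g hgΩ` by
delta) is anisotropic when `V = (E³, H)` is (`hani`), under the dictionary `a 0 = ⟨e₁, e₁⟩_H`, `a 2 = −⟨e₂, e₂⟩_H` of two
`H`-orthogonal lines and `q` describing `E = k(ω)` (`ω² = t ω − n`, `c ω = t − ω`, `c ω ≠ ω`).  The transport of the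
second torus leaves the Gram matrix `B` unchanged, so this is the untransported statement. -/
theorem isAnisotropic_mixedRow_withTransportedTorus_of_anisotropic (H : Matrix (Fin 3) (Fin 3) E)
    (hH : IsCHermitian (IsCMField.complexConj E).toRingEquiv H)
    (hani : Anisotropic (IsCMField.complexConj E).toRingEquiv H)
    (q : QuadData ↥(maximalRealSubfield E)) (ω : E)
    (hω : ω ^ 2 = algebraMap (↥(maximalRealSubfield E)) E q.t * ω - algebraMap (↥(maximalRealSubfield E)) E q.n)
    (hcω : (IsCMField.complexConj E).toRingEquiv ω = algebraMap (↥(maximalRealSubfield E)) E q.t - ω)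
    (hne : (IsCMField.complexConj E).toRingEquiv ω ≠ ω)
    (e₁ e₂ : Fin 3 → E) (horth : hform (IsCMField.complexConj E).toRingEquiv H e₁ e₂ = 0)
    (a : Fin 4 → ↥(maximalRealSubfield E))
    (ha0 : algebraMap (↥(maximalRealSubfield E)) E (a 0) = hform (IsCMField.complexConj E).toRingEquiv H e₁ e₁)
    (ha2 : algebraMap (↥(maximalRealSubfield E)) E (a 2) = -hform (IsCMField.complexConj E).toRingEquiv H e₂ e₂)
    (h₁ : hform (IsCMField.complexConj E).toRingEquiv H e₁ e₁ ≠ 0)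
    (h₂ : hform (IsCMField.complexConj E).toRingEquiv H e₂ e₂ ≠ 0)
    (g g' : Matrix (Fin 4) (Fin 4) ↥(maximalRealSubfield E)) (hgg' : g * g' = 1) (hg'g : g' * g = 1)
    (hgΩ : g * (PlaneData.mixedRow q (a 0) (a 2)).Ω = (PlaneData.mixedRow q (a 0) (a 2)).Ω * g) :
    IsAnisotropic ((PlaneData.mixedRow q (a 0) (a 2)).withTransportedTorus g g' hgg' hg'g hgΩ) :=
  isAnisotropic_mixedRow_of_anisotropic E H hH hani q ω hω hcω hne e₁ e₂ horth a ha0 ha2 h₁ h₂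

end Aniso

end Summit.Ventures.HodgeRepro.Tier4.Line4

end
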